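import Summits.AtomisticToContinuum.Crystallization.Theorems.SquareWellLayerCakeGapTwelveToBarlowCombinatorialLayeringWalk
import Summits.AtomisticToContinuum.Crystallization.Theorems.SquareWellLayerCakeGapTwelveToBarlowCombinatorialLayeringReachFrom
import Summits.AtomisticToContinuum.Crystallization.Theorems.SquareWellLayerCakeGapTwelveToBarlowCombinatorialLayeringModelBall
import Summits.AtomisticToContinuum.Crystallization.Theorems.SquareWellLayerCakeGapTwelveToBarlowCombinatorialLayeringModelWalk

/-!
# Combinatorial layering (B1a of `GapTwelveToBarlow`): the metric closure of a finite development

Crux `SquareWellLayerCake.GapTwelveToBarlow` (stmt-AtomisticToContinuum-15807), line `Sketch`,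
stub `stub_develop` (H_develop).  From a STAR/LINK development `Φ` of the model diamond
(`develop_of_base`) that reaches the centre `x i = Φ p₀` at a covered point with coordinate bounds
`m₀`, and with margins `K ≥ m₀ + 20 W + 10`, `R ≥ 4 m₀ + 120 W + 40` (`W = n₁ + 1`, `D ≤ n₁/60`),
the four clauses of the stub on the `D`-ball about `x i` (`develop_closure`):
* every site of the `D`-ball is reached by a bond walk of length `≤ W` (`exists_walk_of_goodFacets`,
  from **GoodFacets**), hence is the image of a model point within model distance `W` of `p₀`
  (`reach_from`); `φ` = a chosen preimage;
* bonds ↔ unit model distance and the covering of the ideal `D/2`-ball use STAR, the model walks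
  of `exists_modelWalk` (`ℓ ≤ 0.85 D + 2 ≤ D`), and the injectivity residual **H_inj** (no return of
  STAR/LINK developments within half the STAR radius), applied at radius `≤ 12 W` about points
  within `3 W` of `p₀` — all inside the covered diamond by `coords_of_dist_le`.
Nothing is defined; no named fact is used.
-/

noncomputable section

namespace Summit.AtomisticToContinuum.Crystallization.Theorems.SquareWellLayerCakeGapTwelveToBarlow

open Literature.Geometry.DiscreteGeometry Literature.MathematicalPhysics.StatisticalMechanics

/-- **Images along a model walk stay close**: if `Φ` is STAR at every point of a model contact
walk `g` of length `l` starting at a point mapped to `i`, the endpoint is mapped within distance `l`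
of `x i`. [folklore] -/
theorem dist_along_modelWalk {N : ℕ} (x : Fin N → EuclideanSpace ℝ (Fin 3)) (i : Fin N)
    {s : ℤ → ℤ} {Φ : EuclideanSpace ℝ (Fin 3) → Fin N} {g : ℕ → EuclideanSpace ℝ (Fin 3)} {l : ℕ}
    (hg0 : Φ (g 0) = i)
    (hst : ∀ t : ℕ, t < l → g t ∈ barlowStacking 1 (Real.sqrt (2 / 3)) s ∧
      g (t + 1) ∈ barlowStacking 1 (Real.sqrt (2 / 3)) s ∧ dist (g t) (g (t + 1)) = 1)
    (hstar : ∀ t : ℕ, t < l → ∀ q ∈ barlowStacking 1 (Real.sqrt (2 / 3)) s, dist (g t) q = 1 →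
      Φ q ≠ Φ (g t) ∧ dist (x (Φ (g t))) (x (Φ q)) ≤ 1) :
    ∀ t : ℕ, t ≤ l → dist (x i) (x (Φ (g t))) ≤ t := by
  intro t
  induction t with
  | zero => intro _; rw [hg0, dist_self]; simp
  | succ t ih =>
    intro ht
    have h1 := ih (by omega)
    have h2 := (hstar t (by omega) (g (t + 1)) (hst t (by omega)).2.1 (hst t (by omega)).2.2).2
    calc dist (x i) (x (Φ (g (t + 1)))) ≤ dist (x i) (x (Φ (g t))) + dist (x (Φ (g t))) (x (Φ (g (t + 1)))) :=
          dist_triangle _ _ _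
      _ ≤ t + 1 := by linarith
      _ = ((t + 1 : ℕ) : ℝ) := by push_cast; ring

/-- **Images along a model walk stay close** (closed form; the registered anchor of this file).
[folklore] -/
theorem dist_along_modelWalk_of :
    ∀ (N : ℕ) (x : Fin N → EuclideanSpace ℝ (Fin 3)) (i : Fin N) (s : ℤ → ℤ) (Φ : EuclideanSpace
    ℝ (Fin 3) → Fin N) (g : ℕ → EuclideanSpace ℝ (Fin 3)) (l : ℕ), Φ (g 0) = i → (∀ t : ℕ, t < l
    → g t ∈ barlowStacking 1 (Real.sqrt (2 / 3)) s ∧ g (t + 1) ∈ barlowStacking 1 (Real.sqrt (2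
    / 3)) s ∧ dist (g t) (g (t + 1)) = 1) → (∀ t : ℕ, t < l → ∀ q ∈ barlowStacking 1 (Real.sqrt
    (2 / 3)) s, dist (g t) q = 1 → Φ q ≠ Φ (g t) ∧ dist (x (Φ (g t))) (x (Φ q)) ≤ 1) → ∀ t : ℕ,
    t ≤ l → dist (x i) (x (Φ (g t))) ≤ t :=
  fun _ x i _ _ _ _ hg0 hst hstar => dist_along_modelWalk x i hg0 hst hstar

/-- **The metric closure** (see the module docstring). [folklore] -/
theorem develop_closure (hGF : (∀ (N : ℕ) (x : Fin N → EuclideanSpace ℝ (Fin 3)) (i : Fin N), (∀ l : Fin N, dist (x i) (x l) ≤ 4 → ((∀ j' : Fin N, dist (x l) (x j') ≤ 11 / 10 → ∀ k : Fin N, k ≠ j' → (55 : ℝ) / 57 ≤ dist (x j') (x k)) ∧ (Finset.univ.filter fun j' : Fin N => j' ≠ l ∧ dist (x l) (x j') ≤ 1).card = 12 ∧ (Finset.univ.filter fun j' : Fin N => j' ≠ l ∧ dist (x l) (x j') ≤ 11 / 10).card ≤ 12)) → ∀ (n : EuclideanSpace ℝ (Fin 3)) (a b c : Fin N), (∀ l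 : Fin N, l ≠ i → dist (x i) (x l) ≤ 1 → inner ℝ n (x l - x i) ≤ 1) → a ≠ i → b ≠ i → c ≠ i → a ≠ b → b ≠ c → a ≠ c → dist (x i) (x a) ≤ 1 → dist (x i) (x b) ≤ 1 → dist (x i) (x c) ≤ 1 → inner ℝ n (x a - x i) = 1 → inner ℝ n (x b - x i) = 1 → inner ℝ n (x c - x i) = 1 → (dist (x a) (x b) ≤ 1 ∧ dist (x b) (x c) ≤ 1) ∨ (dist (x b) (x c) ≤ 1 ∧ dist (x c) (x a) ≤ 1) ∨ (dist (x c) (x a) ≤ 1 ∧ dist (x a) (x b) ≤ 1))) (hInj : (∀ (N : ℕ) (x : Fin N → EuclideanSpace ℝ (Fin 3)) (s : ℤ → ℤ) (Φ : EuclideanSpace ℝ (Fin 3) → Fin N) (c : EuclideanSpace ℝ (Fin 3)) (ρ : ℝ), IsHaggSeq s → c ∈ barlowStacking 1 (Real.sqrt (2 / 3)) s → (∀ j : Fin N, dist (x (Φ c)) (x j) ≤ 3 * ρ + 6 → ((∀ j' : Fin N, dist (x j) (x j') ≤ 11 / 10 → ∀ k : Fin N, k ≠ j' → (55 : ℝ)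 / 57 ≤ dist (x j') (x k)) ∧ (Finset.univ.filter fun j' : Fin N => j' ≠ j ∧ dist (x j) (x j') ≤ 1).card = 12 ∧ (Finset.univ.filter fun j' : Fin N => j' ≠ j ∧ dist (x j) (x j') ≤ 11 / 10).card ≤ 12)) → (∀ p ∈ barlowStacking 1 (Real.sqrt (2 / 3)) s, dist p c ≤ ρ → ((∀ q ∈ barlowStacking 1 (Real.sqrt (2 / 3)) s, dist p q = 1 → Φ q ≠ Φ p ∧ dist (x (Φ p)) (x (Φ q)) ≤ 1) ∧ (∀ q ∈ barlowStacking 1 (Real.sqrt (2 / 3)) s, ∀ q' ∈ barlowStacking 1 (Real.sqrt (2 / 3)) s, dist p q = 1 → dist p q' = 1 → Φ q = Φ q' → q = q') ∧ (∀ l : Fin N, l ≠ Φ p → dist (x (Φ p)) (x l) ≤ 1 → ∃ q ∈ barlowStacking 1 (Real.sqrt (2 / 3)) s, dist p q = 1 ∧ Φ q = l) ∧ (∀ q ∈ barlowStacking 1 (Real.sqrt (2 / 3)) s, ∀ q' ∈ barlowStacking 1 (Real.sqrt (2 / 3)) s, dist p q = 1 → dist p q' = 1 → q ≠ q' → (dist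 (x (Φ q)) (x (Φ q')) ≤ 1 ↔ dist q q' = 1)))) → ∀ p ∈ barlowStacking 1 (Real.sqrt (2 / 3)) s, dist p c ≤ ρ / 2 → Φ p = Φ c → p = c)) {N : ℕ} (x : Fin N → EuclideanSpace ℝ (Fin 3))
    (i : Fin N) (D : ℝ) (hD : 100 ≤ D) (n₁ : ℕ) (hDn : D ≤ (n₁ : ℝ) / 60)
    (hGood : ∀ j : Fin N, dist (x i) (x j) ≤ 38 * ((n₁ + 1 : ℕ) : ℝ) + 12 → ((∀ j' : Fin N, dist (x j) (x j') ≤ 11 / 10 → ∀ k : Fin N, k ≠ j' → (55 : ℝ) / 57 ≤ dist (x j') (x k)) ∧ (Finset.univ.filter fun j' : Fin N => j' ≠ j ∧ dist (x j) (x j') ≤ 1).card = 12 ∧ (Finset.univ.filter fun j' : Fin N => j' ≠ j ∧ dist (x j) (x j') ≤ 11 / 10).card ≤ 12))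
    {s : ℤ → ℤ} (hs : IsHaggSeq s) (Φ : EuclideanSpace ℝ (Fin 3) → Fin N) (K R m₀ : ℕ) (k₀ i₀ j₀ : ℤ)
    (hΦi : Φ (barlowPos 1 (Real.sqrt (2 / 3)) s k₀ i₀ j₀) = i) (hk₀ : k₀.natAbs ≤ m₀)
    (hsum₀ : j₀.natAbs + i₀.natAbs + 3 * k₀.natAbs ≤ 4 * m₀)
    (hK : m₀ + 20 * (n₁ + 1) + 10 ≤ K) (hR : 4 * m₀ + 120 * (n₁ + 1) + 40 ≤ R)
    (hdev : ∀ k i' j' : ℤ, k.natAbs + 1 ≤ K → j'.natAbs + i'.natAbs + 3 * (k.natAbs + 1) + 4 ≤ R →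
      ((∀ q ∈ barlowStacking 1 (Real.sqrt (2 / 3)) s, dist (barlowPos 1 (Real.sqrt (2 / 3)) s k i' j') q = 1 → Φ q ≠ Φ (barlowPos 1 (Real.sqrt (2 / 3)) s k i' j') ∧ dist (x (Φ (barlowPos 1 (Real.sqrt (2 / 3)) s k i' j'))) (x (Φ q)) ≤ 1) ∧ (∀ q ∈ barlowStacking 1 (Real.sqrt (2 / 3)) s, ∀ q' ∈ barlowStacking 1 (Real.sqrt (2 / 3)) s, dist (barlowPos 1 (Real.sqrt (2 / 3)) s k i' j') q = 1 → dist (barlowPos 1 (Real.sqrt (2 / 3)) s k i' j') q' = 1 → Φ q = Φ q' → q = q') ∧ (∀ l : Fin N, l ≠ Φ (barlowPos 1 (Real.sqrt (2 / 3)) s k i' j') → dist (x (Φ (barlowPos 1 (Real.sqrt (2 / 3)) s k i' j'))) (x l) ≤ 1 → ∃ q ∈ barlowStacking 1 (Real.sqrt (2 / 3)) s, dist (barlowPos 1 (Real.sqrt (2 / 3)) s k i' j') q = 1 ∧ Φ q = l) ∧ (∀ q ∈ barlowStacking 1 (Real.sqrt (2 / 3)) s, ∀ q' ∈ barlowStacking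 1 (Real.sqrt (2 / 3)) s, dist (barlowPos 1 (Real.sqrt (2 / 3)) s k i' j') q = 1 → dist (barlowPos 1 (Real.sqrt (2 / 3)) s k i' j') q' = 1 → q ≠ q' → (dist (x (Φ q)) (x (Φ q')) ≤ 1 ↔ dist q q' = 1)))) :
    ∃ φ : Fin N → EuclideanSpace ℝ (Fin 3), (∀ j : Fin N, dist (x i) (x j) ≤ D → φ j ∈ barlowStacking 1 (Real.sqrt (2 / 3)) s) ∧ (∀ j j' : Fin N, dist (x i) (x j) ≤ D → dist (x i) (x j') ≤ D → j ≠ j' → φ j ≠ φ j') ∧ (∀ j j' : Fin N, dist (x i) (x j) ≤ D → dist (x i) (x j') ≤ D → j ≠ j' → (dist (x j) (x j') ≤ 1 ↔ dist (φ j) (φ j') = 1)) ∧ (∀ p ∈ barlowStacking 1 (Real.sqrt (2 / 3)) s, dist p (φ i) ≤ D / 2 → ∃ j : Fin N, dist (x i) (x j) ≤ D ∧ φ j = p) := by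
  classical
  set W : ℕ := n₁ + 1 with hW
  set p₀ := barlowPos 1 (Real.sqrt (2 / 3)) s k₀ i₀ j₀ with hp₀
  have hWr : ((W : ℕ) : ℝ) = (n₁ : ℝ) + 1 := by rw [hW]; push_cast; ring
  have hW1 : (1 : ℝ) ≤ W := by rw [hWr]; linarith [(Nat.cast_nonneg n₁ : (0:ℝ) ≤ n₁)]
  have hDW : D ≤ W := by rw [hWr]; linarith [(Nat.cast_nonneg n₁ : (0:ℝ) ≤ n₁)]
  -- STAR/LINK at every model point within `15 W` of `p₀`
  have hcov : ∀ p ∈ barlowStacking 1 (Real.sqrt (2 / 3)) s, dist p p₀ ≤ 15 * W → ((∀ q ∈ barlowStacking 1 (Real.sqrt (2 / 3)) s, dist (p) q = 1 → Φ q ≠ Φ (p) ∧ dist (x (Φ (p))) (x (Φ q)) ≤ 1) ∧ (∀ q ∈ barlowStacking 1 (Real.sqrt (2 / 3)) s, ∀ q' ∈ barlowStacking 1 (Real.sqrt (2 / 3)) s, dist (p) q = 1 → dist (p) q' = 1 → Φ q = Φ q' → q = q') ∧ (∀ l : Fin N, l ≠ Φ (p) → dist (x (Φ (p))) (x l) ≤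 1 → ∃ q ∈ barlowStacking 1 (Real.sqrt (2 / 3)) s, dist (p) q = 1 ∧ Φ q = l) ∧ (∀ q ∈ barlowStacking 1 (Real.sqrt (2 / 3)) s, ∀ q' ∈ barlowStacking 1 (Real.sqrt (2 / 3)) s, dist (p) q = 1 → dist (p) q' = 1 → q ≠ q' → (dist (x (Φ q)) (x (Φ q')) ≤ 1 ↔ dist q q' = 1))) := by
    intro p hp hd
    obtain ⟨k, i', j', rfl⟩ := hp
    obtain ⟨h1, h2⟩ := coords_of_dist_le s k₀ i₀ j₀ k i' j' (15 * W) (19 * W) (120 * W) hs hd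
      (by push_cast; linarith) (by push_cast; linarith)
    have e1 : k.natAbs ≤ m₀ + 19 * W := by have := Int.natAbs_sub_le k k₀; omega
    have e2 : j'.natAbs + i'.natAbs + 3 * k.natAbs ≤ 4 * m₀ + 120 * W := by
      have a1 : j'.natAbs ≤ (j' - j₀).natAbs + j₀.natAbs := by
        have := Int.natAbs_add_le (j' - j₀) j₀; rwa [sub_add_cancel] at this
      have a2 : i'.natAbs ≤ (i' - i₀).natAbs + i₀.natAbs := by
        have := Int.natAbs_add_le (i' - i₀) i₀; rwa [sub_add_cancel] at this
      have a3 : k.natAbs ≤ (k - k₀).natAbs + k₀.natAbs := by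
        have := Int.natAbs_add_le (k - k₀) k₀; rwa [sub_add_cancel] at this
      omega
    exact hdev k i' j' (by omega) (by omega)
  -- the injectivity residual, applied near `p₀`
  have hinj : ∀ q ∈ barlowStacking 1 (Real.sqrt (2 / 3)) s, ∀ c ∈ barlowStacking 1 (Real.sqrt (2 / 3)) s, dist q p₀ ≤ 3 * W → dist c p₀ ≤ 3 * W →
      dist (x i) (x (Φ c)) ≤ D → Φ q = Φ c → q = c := by
    intro q hq c hc hdq hdc hcD heq
    have hqc : dist q c ≤ 6 * W := by
      have := dist_triangle q p₀ c; rw [dist_comm p₀ c] at this; linarith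
    refine hInj N x s Φ c (2 * dist q c) hs hc ?_ ?_ q hq (by linarith) heq
    · intro j hj
      exact hGood j (by linarith [dist_triangle (x i) (x (Φ c)) (x j)])
    · intro p hp hpd
      exact hcov p hp (by linarith [dist_triangle p c p₀])
  -- the sites of the `D`-ball are images of model points near `p₀`
  have hreach : ∀ j : Fin N, dist (x i) (x j) ≤ D → ∃ k i' j' : ℤ, Φ (barlowPos 1 (Real.sqrt (2 / 3)) s k i' j') = j ∧
      dist (barlowPos 1 (Real.sqrt (2 / 3)) s k i' j') p₀ ≤ W := by
    intro j hj
    obtain ⟨m, hm, c, hc0, hcm, hcw⟩ := exists_walk_of_goodFacets hGF N x i n₁ j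
      (fun l hl => hGood l (by linarith [hWr, (Nat.cast_nonneg n₁ : (0:ℝ) ≤ n₁)]))
      (hj.trans hDn)
    obtain ⟨k, i', j', -, -, hΦ, hd⟩ := reach_from N x s Φ K R m₀ k₀ i₀ j₀ hs hk₀ hsum₀
      (fun k i' j' hk hij => (hdev k i' j' hk hij).2.2.1) m c (by rw [hc0, hΦi]) hcw (by omega) (by omega)
    refine ⟨k, i', j', by rw [hΦ, hcm], hd.trans ?_⟩
    rw [hW]; exact_mod_cast hm
  choose! fk fi fj hf using hreach
  -- the chart
  refine ⟨fun j => if dist (x i) (x j) ≤ D then barlowPos 1 (Real.sqrt (2 / 3)) s (fk j) (fi j) (fj j) else barlowPos 1 (Real.sqrt (2 / 3)) s 0 0 0,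
    fun j hj => by simp only [if_pos hj]; exact barlowPos_mem _ _ _, ?_, ?_, ?_⟩
  · -- injectivity of `φ` (free: `Φ ∘ φ = id` on the ball)
    intro j j' hj hj' hne heq
    simp only [if_pos hj, if_pos hj'] at heq
    apply hne
    rw [← (hf j hj).1, ← (hf j' hj').1, heq]
  · -- bonds ↔ unit model distance
    intro j j' hj hj' hne
    simp only [if_pos hj, if_pos hj']
    obtain ⟨hΦj, hdj⟩ := hf j hj
    obtain ⟨hΦj', hdj'⟩ := hf j' hj'
    have hSj := hcov _ (barlowPos_mem _ _ _) (hdj.trans (by linarith))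
    constructor
    · intro hb
      obtain ⟨q, hqS, hqd, hqΦ⟩ := hSj.2.2.1 j' (by rw [hΦj]; exact hne.symm) (by rw [hΦj]; exact hb)
      have hq0 : dist q p₀ ≤ 3 * W := by
        have e1 : dist q (barlowPos 1 (Real.sqrt (2 / 3)) s (fk j) (fi j) (fj j)) = 1 := by
          rw [dist_comm]; exact hqd
        linarith [dist_triangle q (barlowPos 1 (Real.sqrt (2 / 3)) s (fk j) (fi j) (fj j)) p₀]
      have := hinj q hqS _ (barlowPos_mem _ _ _) hq0 (hdj'.trans (by linarith)) (by rw [hΦj']; exact hj')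
        (by rw [hqΦ, hΦj'])
      rw [← this, hqd]
    · intro h1
      have := (hSj.1 _ (barlowPos_mem _ _ _) h1).2
      rwa [hΦj, hΦj'] at this
  · -- covering of the ideal `D/2`-ball
    intro p hp hpd
    have hii : dist (x i) (x i) ≤ D := by rw [dist_self]; linarith
    simp only [if_pos hii] at hpd
    obtain ⟨hΦi', hdi⟩ := hf i hii
    obtain ⟨k, i', j', rfl⟩ := hp
    obtain ⟨l, hl, g, hg0, hgl, hst⟩ := exists_modelWalk s (fk i) (fi i) (fj i) k i' j' (D / 2) hs
      (by rw [dist_comm]; exact hpd)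
    have hlD : (l : ℝ) ≤ D := by linarith
    -- every point of the walk is within `15 W` of `p₀`
    have hgnear : ∀ t : ℕ, t ≤ l → dist (g t) p₀ ≤ 15 * W := by
      have hgd : ∀ t : ℕ, t ≤ l → dist (g t) (g 0) ≤ t := by
        intro t
        induction t with
        | zero => intro _; rw [dist_self]; simp
        | succ t ih =>
          intro ht
          calc dist (g (t + 1)) (g 0) ≤ dist (g (t + 1)) (g t) + dist (g t) (g 0) := dist_triangle _ _ _
            _ ≤ 1 + t := by rw [dist_comm, (hst t (by omega)).2.2]; linarith [ih (by omega)]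
            _ = ((t + 1 : ℕ) : ℝ) := by push_cast; ring
      intro t ht
      have h1 := hgd t ht
      rw [hg0] at h1
      have : dist (g t) p₀ ≤ t + W := by linarith [dist_triangle (g t) (barlowPos 1 (Real.sqrt (2 / 3)) s (fk i) (fi i) (fj i)) p₀]
      have ht' : (t : ℝ) ≤ l := by exact_mod_cast ht
      linarith
    have hstar : ∀ t : ℕ, t < l → ∀ q ∈ barlowStacking 1 (Real.sqrt (2 / 3)) s, dist (g t) q = 1 →
        Φ q ≠ Φ (g t) ∧ dist (x (Φ (g t))) (x (Φ q)) ≤ 1 := fun t ht =>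
      (hcov (g t) (hst t ht).1 (hgnear t (by omega))).1
    have hdist := dist_along_modelWalk x i (by rw [hg0, hΦi']) hst hstar l le_rfl
    rw [hgl] at hdist
    refine ⟨Φ (barlowPos 1 (Real.sqrt (2 / 3)) s k i' j'), hdist.trans hlD, ?_⟩
    have hjD : dist (x i) (x (Φ (barlowPos 1 (Real.sqrt (2 / 3)) s k i' j'))) ≤ D := hdist.trans hlD
    simp only [if_pos hjD]
    obtain ⟨hΦj, hdj⟩ := hf _ hjD
    have hpp₀ : dist (barlowPos 1 (Real.sqrt (2 / 3)) s k i' j') p₀ ≤ 3 * W := by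
      have := hgnear l le_rfl; rw [hgl] at this
      have h2 : dist (barlowPos 1 (Real.sqrt (2 / 3)) s k i' j') (barlowPos 1 (Real.sqrt (2 / 3)) s (fk i) (fi i) (fj i)) ≤ D / 2 := hpd
      linarith [dist_triangle (barlowPos 1 (Real.sqrt (2 / 3)) s k i' j') (barlowPos 1 (Real.sqrt (2 / 3)) s (fk i) (fi i) (fj i)) p₀]
    exact hinj _ (barlowPos_mem _ _ _) _ (barlowPos_mem _ _ _) (hdj.trans (by linarith)) hpp₀ hjD hΦj

end Summit.AtomisticToContinuum.Crystallization.Theorems.SquareWellLayerCakeGapTwelveToBarlow
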